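import Summits.HodgeConjecture.HodgeConjecture.Theorems.NoetherLefschetzOneUpLevelZeroNets

/-!
# Route NoetherLefschetzOneUp — `LevelZeroNets` (stmt-HodgeConjecture-11602), IV:
# descent to "algebraic ⊔ vertical", and the item from the `(p,p)`-type of algebraic classes

File III (`NoetherLefschetzOneUpLevelZeroNets`, v2) derived `LevelZeroNets` from the `V`-part
(`Arapura2022_thm_1_2_smoothPart_pgZeroSurfaceFibration`: Arapura 2022, Thm. 1.2 as applied in the
proof of Cor. 1.5 — every rational `(2,2)`-class agrees off some vertical divisor `f⁻¹T` with an
algebraic class) and Grothendieck's coniveau inclusion `Nˢ Hᵏ ⊆ ⨆_{p,q ≥ s} H^{p,q}` for ALL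
`(k, s)` (`Grothendieck1969_supportedClasses_le_hodgeConiveau`), which the tree discharges only
through Deligne's Hodge III Cor. 8.2.8 (mixed Hodge theory, no carrier). But that proof uses the
coniveau inclusion at the single spot `(k, s) = (4, 2)` and only for RATIONAL classes: "a rational
algebraic class of codimension `2` on a smooth projective fourfold is of type `(2,2)`" — the
`(2p, p)`-SLICE "the class of an algebraic cycle is of type `(p,p)`" (Deligne 2000, §1; Voisin I,
Prop. 11.20), which has a Deligne-free road on the tree's carriers (purity of the coniveau pieces,
`exists_ker_restrictCompl_le_span_of_isIrreducible` of `SupportedClassesPurity`, PROVED, with the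
bidegree of the Gysin classes of resolutions, `isOfHodgeType_complexGysin`, PROVED) and is filed
verbatim as the support item `AlgebraicClassesHodgeType` of route `AmpleAdicLefschetz`
(stmt-HodgeConjecture-15189). This file

* isolates the linear algebra of file III v2 as a reusable DESCENT LEMMA
  `LevelZeroNetsDescent.span_le_algebraicClasses_sup_span_vertical` — for ANY smooth projective
  `X`, codimension `p` and family of supports `Z i`: if rational algebraic classes of codimension
  `p` are `(p,p)` in every Hodge model and every rational `(p,p)`-class agrees off one `Z i` with
  an algebraic class, then `span {rational (p,p)} ≤ algebraicClasses X p ⊔ span {rational (p,p)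
  dying off some Z j}` (the shape shared by `LevelZeroNets`, `K3TypeNets` and the retired
  `GeneralTypeNets` of this route, with `Z T = f⁻¹T` over the proper closed `T ⊊ ℙ²`);
* derives the item from the SLICE in dimension `4`, codimension `2`, rational classes
  (`levelZeroNets_of_hodgeType_smoothPart`) and, as a convenience, from the slice in the exact
  shape of stmt-HodgeConjecture-15189 (`levelZeroNets_of_algebraicClassesHodgeType_smoothPart`):
  once that item's theorem and `Arapura2022_thm_1_2_smoothPart_pgZeroSurfaceFibration_holds` land,
  `LevelZeroNets` is the one-liner
  `levelZeroNets_of_algebraicClassesHodgeType_smoothPart ‹slice› ‹V-part›`; file III's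
  `levelZeroNets_of_smoothPart hG` is the instance `hH := (hodgeConiveau 4 2 ≤ H^{2,2}) ∘ hG`.

So the trust base of the item is ONE named fact with no carrier (the `V`-part: Leray filtration,
decomposition theorem, relative Hilbert schemes) plus one support item with an in-tree road.
Everything here is proved; no definitions, no named facts.
-/

set_option linter.dupNamespace false

noncomputable section

namespace Summit.HodgeConjecture.HodgeConjecture.Theorems

open CategoryTheory AlgebraicGeometry
open Literature.AlgebraicTopology.SingularHomology
open Literature.AlgebraicGeometry.Motives Literature.AlgebraicGeometry.HodgeTheory
open Summit.HodgeConjecture.HodgeConjecture.Theses.NoetherLefschetzOneUp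

namespace LevelZeroNetsDescent

/-- **Descent to "algebraic ⊔ vertical Hodge classes"** (the linear algebra of Arapura's proof of
Cor. 1.5 from Thm. 1.2, p. 5, made model-free). Let `X` be smooth projective of dimension `n`,
`p : ℕ`, and `Z : ι → Set X` a family of supports. Assume (i) every RATIONAL algebraic class of
codimension `p` on `X` is of type `(p,p)` in every Hodge model (the `(2p,p)`-slice of
Grothendieck's coniveau inclusion; Deligne 2000, §1: "`cl(Z)` is of type `(p,p)`"), and (ii) for
some `i`, every rational `(p,p)`-class `c` agrees off `Z i` with an algebraic class `b`, i.e.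
`(c - b)|_{(X ∖ Z i)(ℂ)} = 0`. Then the span of the rational `(p,p)`-classes lies in
`algebraicClasses X p ⊔ span {rational (p,p)-classes dying off some Z j}`. Proof: `b` is a complex
combination of RATIONAL algebraic classes (`supportedClasses_le_span_isRationalClass`) and `c - b`
of RATIONAL classes dying off `Z i` (`mem_span_isRationalClass_of_map_eq_zero`, rational classes
spanning `H²ᵖ(X(ℂ); ℂ)`), so by rational descent (`exists_add_of_mem_span_union`) `c = a + a'` with
`a` rational algebraic and `a'` rational dying off `Z i`; and `a' = (a + a') - a` is of type
`(p,p)` in the model exhibiting `c`, because `a` is, by (i).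
[cite: Arapura2022, proof of Cor. 1.5 (p. 5)] [cite: Deligne2000, §1]
[cite: VoisinHodgeI2002, §7.1.1 and Prop. 11.20] -/
theorem span_le_algebraicClasses_sup_span_vertical {n p : ℕ} {X : SchemeOver ℂ}
    (hX : IsSmoothProjective n X)
    (hH : ∀ (A : HodgeModel n X), ∀ a ∈ algebraicClasses X p, IsRationalClass a →
      A.pullback (2 * p) a ∈ A.hodgePQ (2 * p) p p)
    {ι : Sort*} (Z : ι → Set X.left)
    (hV : ∃ i, ∀ c : complexBetti X (2 * p), IsRationalClass c →
      IsOfHodgeType n X (2 * p) p p c →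
        ∃ b ∈ algebraicClasses X p, complexBetti.restrictCompl X (Z i) (2 * p) (c - b) = 0) :
    Submodule.span ℂ {c : complexBetti X (2 * p) |
        IsRationalClass c ∧ IsOfHodgeType n X (2 * p) p p c} ≤
      algebraicClasses X p ⊔ Submodule.span ℂ {c : complexBetti X (2 * p) |
        IsRationalClass c ∧ IsOfHodgeType n X (2 * p) p p c ∧
          ∃ i, complexBetti.restrictCompl X (Z i) (2 * p) c = 0} := by
  obtain ⟨i, hV⟩ := hV
  refine Submodule.span_le.mpr ?_
  rintro c ⟨hc, hcpp⟩
  obtain ⟨b, hbA, hcb⟩ := hV c hc hcpp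
  -- the two rational generating sets: rational algebraic classes, rational classes dying off `Z i`
  set SA : Set (complexBetti X (2 * p)) :=
    {x | IsRationalClass x ∧ x ∈ algebraicClasses X p} with hSA
  set SK : Set (complexBetti X (2 * p)) :=
    {x | IsRationalClass x ∧ complexBetti.restrictCompl X (Z i) (2 * p) x = 0} with hSK
  have hb : b ∈ Submodule.span ℂ SA := supportedClasses_le_span_isRationalClass hX (2 * p) p hbA
  have hk : c - b ∈ Submodule.span ℂ SK :=
    mem_span_isRationalClass_of_map_eq_zero _
      (by rw [span_isRationalClass_eq_top_of_isSmoothProjective_holds n X hX (2 * p)]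
          exact Submodule.mem_top) hcb
  have hmem : c ∈ Submodule.span ℂ (SA ∪ SK) := by
    rw [Submodule.span_union]
    simpa only [add_sub_cancel] using Submodule.add_mem_sup hb hk
  -- rational descent: `c = a + a'`, `a` rational algebraic, `a'` rational dying off `Z i`
  obtain ⟨a, a', ha, ha', haA, haK, rfl⟩ :=
    exists_add_of_mem_span_union (fun x hx ↦ hx.1) (fun x hx ↦ hx.1) hc hmem
  have haA' : a ∈ algebraicClasses X p :=
    (Submodule.span_le.mpr fun x hx ↦ hx.2 : Submodule.span ℂ SA ≤ algebraicClasses X p) haA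
  have haK' : complexBetti.restrictCompl X (Z i) (2 * p) a' = 0 := by
    have hle : Submodule.span ℂ SK ≤
        LinearMap.ker (complexBetti.restrictCompl X (Z i) (2 * p)).hom :=
      Submodule.span_le.mpr fun x hx ↦ hx.2
    exact hle haK
  refine Submodule.add_mem_sup haA' (Submodule.subset_span ⟨ha', ?_, i, haK'⟩)
  -- Hodge type `(p,p)` of `a' = (a + a') - a` in the model exhibiting `a + a'`: by (i) for `a`
  obtain ⟨A, hA⟩ := hcpp
  refine ⟨A, ?_⟩
  have hpa : A.pullback (2 * p) a ∈ A.hodgePQ (2 * p) p p := hH A a haA' ha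
  have hsplit : A.pullback (2 * p) a' = A.pullback (2 * p) (a + a') - A.pullback (2 * p) a := by
    rw [map_add, add_sub_cancel_left]
  rw [hsplit]
  exact Submodule.sub_mem _ hA hpa

end LevelZeroNetsDescent

/-- **`LevelZeroNets` from the `V`-part and the `(4,2)`-slice "rational algebraic classes of
codimension `2` on a smooth projective fourfold are of type `(2,2)`".** Hypotheses: `hH` — for
every smooth projective fourfold `X`, every Hodge model `A` and every rational
`a ∈ algebraicClasses X 2`, `A.pullback 4 a ∈ H^{2,2}(A)` (Deligne 2000 §1 / Voisin I Prop. 11.20;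
in the tree: the `(n, p) = (4, 2)` instance of item stmt-HodgeConjecture-15189, or of
`Grothendieck1969_supportedClasses_le_hodgeConiveau` through `hodgeConiveau 4 2 ≤ H^{2,2}`);
`hVpart` — Arapura 2022, Thm. 1.2 as applied in the proof of Cor. 1.5. Proof: at `Y = ℙ²_ℂ`
(`isSmoothProjective_projectiveSpace_holds`) all fibres of the item's `f` are connected
(`LevelZeroNetsStein.geometricallyConnected_of_net`, proved in file III), so the `V`-part yields a
proper closed `T` off whose preimage every rational `(2,2)`-class is algebraic; the descent lemma
`LevelZeroNetsDescent.span_le_algebraicClasses_sup_span_vertical` with the family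
`T' ↦ f⁻¹T'` over the proper closed `T' ⊊ ℙ²` gives the item. CONDITIONAL on `hVpart` (named
fact, no carrier) and `hH`. [cite: Arapura2022, Thm. 1.2 and proof of Cor. 1.5 (p. 5)]
[cite: Deligne2000, §1] -/
theorem levelZeroNets_of_hodgeType_smoothPart
    (hH : ∀ ⦃X : SchemeOver ℂ⦄, IsSmoothProjective 4 X → ∀ (A : HodgeModel 4 X),
      ∀ a ∈ algebraicClasses X 2, IsRationalClass a →
        A.pullback (2 * 2) a ∈ A.hodgePQ (2 * 2) 2 2)
    (hVpart : Arapura2022_thm_1_2_smoothPart_pgZeroSurfaceFibration) : LevelZeroNets := by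
  intro X f hX hf hgen
  have hconn : ∀ y : ↥(projectiveSpace 2 ℂ).left,
      _root_.IsPreconnected (f.left.base ⁻¹' {y}) :=
    isPreconnected_preimage_singleton_of_geometricallyConnected f
      (LevelZeroNetsStein.geometricallyConnected_of_net f hX hf hgen)
  obtain ⟨T, hT, hTne, hV⟩ :=
    hVpart f hX (isSmoothProjective_projectiveSpace_holds ℂ 2) hf hconn hgen
  -- descent along the family `T' ↦ f⁻¹T'` of preimages of the proper closed subsets of `ℙ²`
  have key := LevelZeroNetsDescent.span_le_algebraicClasses_sup_span_vertical hX (hH hX)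
    (fun T' : {T' : Set (projectiveSpace 2 ℂ).left // IsClosed T' ∧ T' ≠ Set.univ} ↦
      f.left.base ⁻¹' T'.1)
    ⟨⟨T, hT, hTne⟩, hV⟩
  refine key.trans (sup_le_sup_left (Submodule.span_mono ?_) _)
  rintro c ⟨hc, hcpp, ⟨T', hT', hT'ne⟩, h0⟩
  exact ⟨hc, hcpp, T', hT', hT'ne, h0⟩

/-- **`LevelZeroNets` from the `V`-part and "algebraic classes are of Hodge type `(p,p)`"** in the
exact shape of the support item `AlgebraicClassesHodgeType` of route `AmpleAdicLefschetz`
(stmt-HodgeConjecture-15189: for every smooth projective `X` of dimension `n`, every Hodge model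
`A`, every `p` and every `c ∈ algebraicClasses X p`, `A.pullback (2p) c ∈ H^{p,p}(A)` — Deligne
2000 §1, Voisin I Prop. 11.20; in-tree road: purity of the coniveau pieces + the bidegree of the
Gysin classes of resolutions). Once that item's theorem and
`Arapura2022_thm_1_2_smoothPart_pgZeroSurfaceFibration_holds` are in the tree, `LevelZeroNets` is
`levelZeroNets_of_algebraicClassesHodgeType_smoothPart ‹that theorem› ‹_holds›`: the item then
rests on the `V`-part alone among named facts. [cite: Arapura2022, Thm. 1.2 and proof of Cor. 1.5 (p. 5)]
[cite: Deligne2000, §1] [cite: VoisinHodgeI2002, Prop. 11.20] -/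
theorem levelZeroNets_of_algebraicClassesHodgeType_smoothPart
    (hH : ∀ ⦃n : ℕ⦄ ⦃X : SchemeOver ℂ⦄, IsSmoothProjective n X →
      ∀ (A : HodgeModel n X) (p : ℕ), ∀ c ∈ algebraicClasses X p,
        A.pullback (2 * p) c ∈ A.hodgePQ (2 * p) p p)
    (hVpart : Arapura2022_thm_1_2_smoothPart_pgZeroSurfaceFibration) : LevelZeroNets :=
  levelZeroNets_of_hodgeType_smoothPart (fun _ hX A a ha _ ↦ hH hX A 2 a ha) hVpart

end Summit.HodgeConjecture.HodgeConjecture.Theorems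

end
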